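import Summits.QuantumFields.YangMills.Theorems.BalabanUVNodesN19TargetOfSourceLocalGasReading
import Summits.QuantumFields.YangMills.Theorems.BalabanUVNodesN19TargetOfDecorrelationReading

/-!
# YM-DAG node N19 (= NE7 proper) — THE CAPSTONE OF THE CLASS-GAS READING: with SOURCE-FREE class prefactors, node U5's `Target` needs NO two-run
# comparison of the prefactors AT ALL.  Per class, the response matching (RM) IS the source-local Kotecký–Preiss two-run bound of the class gas
# (the prefactors — old large-field block factors, counterterms — CANCEL in the increments); with the decorrelation letter (DC) the generating
# functions match along `K` ⇒ `MatchingModConstants` (canonical constants) ⇒ `Target`.  The prefactor contrast `η` of the `Core` face drops out.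

Cell `pub-ymgap`, HUMAN RULING D-0062 (Track A), width seat `pub-ymgap-dag-n19-w2` (node n19 = NE7), generation g7 (R455 (A) rule (ii); CLAIM-3 on the cell
bus).  Route `Summits/QuantumFields/YangMills/Theses/BalabanUVNodes.lean`, key item K3⁸ `SpineGivenEndpointR13SepCoPHV` (stmt-QuantumFields-27366; aside
predecessor K3⁷ 20544); filed `--kind proof --supports … --as helper`.  COUNT-NEUTRAL.  THEOREMS ONLY (0 `def`, 0 `sorry`).  v1 p627902 (§1–§3); v1.1 = + §4–§5, v1's text byte-identical.  ADDITIVE — imports this seat's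
g7 FILE B `…N19TargetOfSourceLocalGasReading` (p625536: `abs_log_re_incr_sub_incr_le_local`) and FILE C `…N19TargetOfDecorrelationReading`
(`abs_genFunIncr_sub_le_of_response_decorrelation`, `target_of_responseDecorrelationReading`); through them the tree's KERNEL-PROVED Kotecký–Preiss library
(`Literature.Probability.LatticeModels.*`), dag-n19-e's `…N19CoreMetric`, `Spine/NE7/Targets` — all BY NAME; modifies nothing.

THE THREE FILES IN ONE SENTENCE.  FILE A (p625462): in a class-gas reading `A = F_A·Z(Λ; w_A)`, `B = F_B·Z(Λ; w_B)` the `Core` face — ONE constant per `K`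
over all good classes — costs `ρ + W + η ≤ vol·δ_K` where `η` bounds the PREFACTOR CONTRAST `|log F_B(τ) − log F_A(τ) − c₀|` uniformly in the class:
the locus of the crux card window-key-core's obstruction (old large-field block factors: `η_K ≈ n_K(τ)·D₀`, extensive, law-separating).  FILE C: node U5's
`Target` does not need `Core`'s constant — it follows from (RM) two-run matching of the source RESPONSES class by class + (DC) decorrelation of contrast
and response under run A's source-free class law.  THIS FILE: when the class prefactors are SOURCE-FREE (`t`-independent: the loop does not enter the
old∕large-field block factors), (RM) holds per class with radius = FILE B's DISCOUNTED source-local two-run activity budget of the class gas — the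
prefactors CANCEL in the increments, WHATEVER their two-run contrast (§1) — so along `K` the node's `Target` follows from: Kotecký–Preiss for both
runs' class gases, source locality of the activities, the discounted two-run activity rate near the loop, and (DC) — with NO hypothesis on `F_B∕F_A`
(§2).  The extensive old-block contrast is invisible to the TARGET exactly to the extent that it DECORRELATES from the loop's response ((DC)); it is
fatal only for the `Core` ROAD.

WHAT IS KERNEL-CHECKED ([folklore] algebra over the two imported files BY NAME).
* §1 `responseMatching_of_classGas` — ONE class, one `K`: `A_s = F_A·Z(L; w_A^s).re`, `B_s = F_B·Z(L; w_B^s).re` (`s ∈ {t, 0}`), source-free positive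
  prefactors, REAL activities dominated by a common profile `ω` obeying hypothesis (1) with weight `d + e`, source locality off `S` per run, discount `m` on
  the clusters meeting `S` ⇒ `|(log B_t − log B_0) − (log A_t − log A_0)| ≤ Σ_{δ∈L} e^{−m δ}(‖w_A^t δ − w_B^t δ‖ + ‖w_A^0 δ − w_B^0 δ‖)e^{a δ + d δ + e δ}` — (RM)
  with NO prefactor term.
* §2 `target_of_classGasDecorrelationReading` — ALONG `K`, all classes of `T K` good (the hybrid split composes through FILE D's `…_bad` edition, not
  repeated): per `(K, τ)` a class gas (volume `L K τ`, seen set `S K τ`, activities `w_X K τ t`, profile∕weights∕discount `ω a d e m K τ`), source-free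
  prefactors `F_X K τ > 0`, the dictionary `Z K t = Σ_{T K} A K t`, `Z (K+1) t = Σ_{T K} B K t` with `X K t τ = F_X K τ · Z(L K τ; w_X K τ t).re`, the
  class-uniform discounted budget `≤ r K`, (DC)_K with `κ K`, `r K + κ K ≤ vol·δ K`, `Summable δ` ⇒ `NE7.Target vol l₀ δ Z`.
* §3 SANITY (A6): an `example` — one class, the empty polymer volume, unit prefactors: every hypothesis inhabited, `Target 1 l₀ 0 1` (content-free;
  joint satisfiability only; kept as an `example` because the statement coincides with FILE B's landed `target_of_sourceLocalReading_empty`).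
* §4 (v1.1, APPEND-ONLY) `responseMatching_of_classGas_sourcedPrefactor` — classes whose block factors FEEL the loop: (RM) = the prefactors' own two-run response
  matching `r_F` (recent large-field blocks at the loop, a BINDER) + the gas budget.  §5 (v1.1) `target_of_responseDecorrelationReading_of_injectedRate` — budgets
  bounded by node U4's transported injected rate `vol·T4CauchySum.delta E ρ inj K` (`InjectedRate C c θ inj`, `θ, ρ ∈ [0,1[`) are summable (`summable_delta`) ⇒ `Target`.

HONEST FRAMING.  Hypothesis SHAPES (class-gas reading of the two runs' class weights, source-free prefactors, KP for both runs, source locality, the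
discounted two-run activity rate, (DC)) produced by nobody for Bałaban's runs — in particular SOURCE-FREENESS of the class prefactors is a modelling
clause (the loop's support must avoid the blocks the prefactors integrate; classes where it does not would go to the bad set of FILE D's hybrid edition,
whose weight is then owed), and (DC) is an unprinted aging∕locality statement; [LF-II] (1.98) is the printed ONE-run format only; ZERO Bałaban content;
NE7 ∕ NE7b ∕ NE7c NOT PRINTED for d = 4 ∕ NOT proved; N19 ∕ N20 NOT discharged; K3⁸ 27366 OPEN («v6» pending registration), K3⁷ 20544 aside, neither
claimed — K3's stub 2 is typed on the `Core` road and is NOT served by this `Target`-level face (a re-line would be the planner's); counts UNMOVED (typed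
28∕28 · discharged 5∕27, A 5∕28); no count claim.  One finite four-torus programme at fixed ε, Bałaban AS PRINTED; R4 closes the conditional finite-𝕋⁴
rung `BalabanLadder.UV` only — NOT infinite volume, NOT OS on ℝ⁴, NOT the Yang–Mills mass gap, NOT the Clay problem.  0 `def`; 0 `sorry`; standard axioms.
-/

noncomputable section

open Finset
open scoped BigOperators

namespace Summit.QuantumFields.YangMills.BalabanUVNodes.N19TargetOfClassGasDecorrelation

open Literature.Probability.LatticeModels
open Literature.MathematicalPhysics.QuantumFieldTheory.Balaban1983to89.T4CauchySum (MatchingModConstants)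
open Summit.QuantumFields.BalabanUV.T4Continuum.Spine
open Summit.QuantumFields.YangMills.BalabanUVNodes.N19TargetOfSourceLocalGasReading (abs_log_re_incr_sub_incr_le_local)
open Summit.QuantumFields.YangMills.BalabanUVNodes.N19TargetOfDecorrelationReading (target_of_responseDecorrelationReading)

variable {P : Type*} [DecidableEq P] {inc : P → P → Prop} [DecidableRel inc] [Std.Refl inc] [Std.Symm inc]

/-! ## §1 ONE class: source-free prefactors cancel — (RM) IS the discounted source-local two-run bound of the class gas -/

/-- **RESPONSE MATCHING OF A CLASS GAS WITH SOURCE-FREE PREFACTORS.**  Class weights `A_s = FA · Z(L; wA_s).re`, `B_s = FB · Z(L; wB_s).re` at the source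
values `s = t` (families `wA`, `wB`) and `s = 0` (families `wA₀`, `wB₀`), with positive `t`-INDEPENDENT prefactors `FA`, `FB` and the hypotheses of FILE B's
`abs_log_re_incr_sub_incr_le_local` (real activities, common dominating profile obeying (1) with weight `d + e`, source locality off `S`, discount `m`): the
prefactors CANCEL in the increments and `|(log B_t − log B_0) − (log A_t − log A_0)| ≤` the discounted two-run activity budget — (RM) for this class with NO
term in `FB ∕ FA`. [folklore] -/
theorem responseMatching_of_classGas {wA wA₀ wB wB₀ : P → ℂ} {ω a d e m : P → ℝ} {L S : Finset P} {FA FB : ℝ}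
    (ha : ∀ γ, 0 ≤ a γ) (hd : ∀ γ, 0 ≤ d γ) (he : ∀ γ, 0 ≤ e γ)
    (hωA : ∀ δ ∈ L, ‖wA δ‖ ≤ ω δ) (hωA₀ : ∀ δ ∈ L, ‖wA₀ δ‖ ≤ ω δ) (hωB : ∀ δ ∈ L, ‖wB δ‖ ≤ ω δ) (hωB₀ : ∀ δ ∈ L, ‖wB₀ δ‖ ≤ ω δ)
    (hdom : ∀ γ ∈ L, ∑ γ' ∈ L with inc γ' γ, ω γ' * Real.exp (a γ' + (d γ' + e γ')) ≤ a γ)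
    (hAr : ∀ γ, (wA γ).im = 0) (hA₀r : ∀ γ, (wA₀ γ).im = 0) (hBr : ∀ γ, (wB γ).im = 0) (hB₀r : ∀ γ, (wB₀ γ).im = 0)
    (hSA : ∀ γ ∈ L, γ ∉ S → wA γ = wA₀ γ) (hSB : ∀ γ ∈ L, γ ∉ S → wB γ = wB₀ γ)
    (hm : ∀ C ⊆ L, (C ∩ S).Nonempty → IsPolymerCluster inc C → ∀ δ ∈ C, m δ ≤ ∑ γ ∈ C, e γ)
    (hFA : 0 < FA) (hFB : 0 < FB) :
    0 < FA * (polymerPartitionFunction inc wA L).re ∧ 0 < FA * (polymerPartitionFunction inc wA₀ L).re ∧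
    0 < FB * (polymerPartitionFunction inc wB L).re ∧ 0 < FB * (polymerPartitionFunction inc wB₀ L).re ∧
    |(Real.log (FB * (polymerPartitionFunction inc wB L).re) - Real.log (FB * (polymerPartitionFunction inc wB₀ L).re)) -
        (Real.log (FA * (polymerPartitionFunction inc wA L).re) - Real.log (FA * (polymerPartitionFunction inc wA₀ L).re))| ≤
      ∑ δ ∈ L, Real.exp (-m δ) * ((‖wA δ - wB δ‖ + ‖wA₀ δ - wB₀ δ‖) * Real.exp (a δ + (d δ + e δ))) := by
  obtain ⟨hpA, hpA₀, hpB, hpB₀, hincr⟩ :=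
    abs_log_re_incr_sub_incr_le_local ha hd he hωA hωA₀ hωB hωB₀ hdom hAr hA₀r hBr hB₀r hSA hSB hm
  refine ⟨mul_pos hFA hpA, mul_pos hFA hpA₀, mul_pos hFB hpB, mul_pos hFB hpB₀, ?_⟩
  rw [Real.log_mul hFB.ne' hpB.ne', Real.log_mul hFB.ne' hpB₀.ne', Real.log_mul hFA.ne' hpA.ne', Real.log_mul hFA.ne' hpA₀.ne']
  have e : Real.log FB + Real.log (polymerPartitionFunction inc wB L).re - (Real.log FB + Real.log (polymerPartitionFunction inc wB₀ L).re) -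
      (Real.log FA + Real.log (polymerPartitionFunction inc wA L).re - (Real.log FA + Real.log (polymerPartitionFunction inc wA₀ L).re)) =
      (Real.log (polymerPartitionFunction inc wB L).re - Real.log (polymerPartitionFunction inc wA L).re) -
        (Real.log (polymerPartitionFunction inc wB₀ L).re - Real.log (polymerPartitionFunction inc wA₀ L).re) := by ring
  rw [e]
  exact hincr

/-! ## §2 ALONG `K`: the class-gas reading with source-free prefactors + (DC) ⇒ `Target` — no hypothesis on the prefactor contrast -/

/-- **NODE U5's `Target` FROM THE CLASS-GAS READING WITH SOURCE-FREE PREFACTORS AND THE DECORRELATION LETTER.**  Per `(K, τ)`, `τ ∈ T K` (nonempty,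
all classes good): a class gas on the volume `L K τ` with seen set `S K τ`, REAL activities `wA K τ t`, `wB K τ t` dominated (for `|t| ≤ l₀`) by a profile
`ω K τ` obeying (1) with weight `d K τ + e K τ`, source-local off `S K τ`, discount `m K τ` on the clusters meeting `S K τ`; SOURCE-FREE positive prefactors
`FA K τ`, `FB K τ` (NO two-run comparison of them is asked); the class weights READ as `A K t τ = FA K τ · Z(L K τ; wA K τ t).re`, `B K t τ = FB K τ · Z(…; wB K τ t).re`;
the dictionary `Z K t = Σ_{T K} A K t`, `Z (K+1) t = Σ_{T K} B K t`; the discounted two-run activity budget of every class `≤ r K`; (DC)_K with radius `κ K`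
(displayed on the class weights as in FILE C); `r K + κ K ≤ vol·δ K`, `Summable δ`, `0 ≤ l₀` ⇒ `NE7.Target vol l₀ δ Z`. [folklore] -/
theorem target_of_classGasDecorrelationReading {ι : Type*} {l₀ vol : ℝ} {δ : ℕ → ℝ} {Z : ℕ → ℝ → ℝ} (hl₀ : 0 ≤ l₀)
    (T : ℕ → Finset ι) (L S : ℕ → ι → Finset P) (wA wB : ℕ → ι → ℝ → P → ℂ) (ω a d e m : ℕ → ι → P → ℝ) (FA FB : ℕ → ι → ℝ)
    (A B : ℕ → ℝ → ι → ℝ) (r κ : ℕ → ℝ)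
    (hT : ∀ K, (T K).Nonempty)
    (ha : ∀ K τ γ, 0 ≤ a K τ γ) (hd : ∀ K τ γ, 0 ≤ d K τ γ) (he : ∀ K τ γ, 0 ≤ e K τ γ)
    (hωA : ∀ K, ∀ τ ∈ T K, ∀ t, |t| ≤ l₀ → ∀ δ' ∈ L K τ, ‖wA K τ t δ'‖ ≤ ω K τ δ')
    (hωB : ∀ K, ∀ τ ∈ T K, ∀ t, |t| ≤ l₀ → ∀ δ' ∈ L K τ, ‖wB K τ t δ'‖ ≤ ω K τ δ')
    (hdom : ∀ K, ∀ τ ∈ T K, ∀ γ ∈ L K τ, ∑ γ' ∈ L K τ with inc γ' γ, ω K τ γ' * Real.exp (a K τ γ' + (d K τ γ' + e K τ γ')) ≤ a K τ γ)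
    (hAr : ∀ K τ t γ, (wA K τ t γ).im = 0) (hBr : ∀ K τ t γ, (wB K τ t γ).im = 0)
    (hSA : ∀ K, ∀ τ ∈ T K, ∀ t, |t| ≤ l₀ → ∀ γ ∈ L K τ, γ ∉ S K τ → wA K τ t γ = wA K τ 0 γ)
    (hSB : ∀ K, ∀ τ ∈ T K, ∀ t, |t| ≤ l₀ → ∀ γ ∈ L K τ, γ ∉ S K τ → wB K τ t γ = wB K τ 0 γ)
    (hm : ∀ K, ∀ τ ∈ T K, ∀ C ⊆ L K τ, (C ∩ S K τ).Nonempty → IsPolymerCluster inc C → ∀ δ' ∈ C, m K τ δ' ≤ ∑ γ ∈ C, e K τ γ)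
    (hFA : ∀ K τ, 0 < FA K τ) (hFB : ∀ K τ, 0 < FB K τ)
    (hAread : ∀ K t, |t| ≤ l₀ → ∀ τ ∈ T K, A K t τ = FA K τ * (polymerPartitionFunction inc (wA K τ t) (L K τ)).re)
    (hBread : ∀ K t, |t| ≤ l₀ → ∀ τ ∈ T K, B K t τ = FB K τ * (polymerPartitionFunction inc (wB K τ t) (L K τ)).re)
    (hZA : ∀ K t, |t| ≤ l₀ → Z K t = ∑ τ ∈ T K, A K t τ) (hZB : ∀ K t, |t| ≤ l₀ → Z (K + 1) t = ∑ τ ∈ T K, B K t τ)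
    (hbud : ∀ K, ∀ τ ∈ T K, ∀ t, |t| ≤ l₀ →
      ∑ δ' ∈ L K τ, Real.exp (-m K τ δ') * ((‖wA K τ t δ' - wB K τ t δ'‖ + ‖wA K τ 0 δ' - wB K τ 0 δ'‖) *
        Real.exp (a K τ δ' + (d K τ δ' + e K τ δ'))) ≤ r K)
    (hDC : ∀ K t, |t| ≤ l₀ →
      |Real.log (∑ τ ∈ T K, B K 0 τ * (A K t τ / A K 0 τ)) - Real.log (∑ τ ∈ T K, B K 0 τ) -
        (Real.log (∑ τ ∈ T K, A K t τ) - Real.log (∑ τ ∈ T K, A K 0 τ))| ≤ κ K)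
    (hδbud : ∀ K, r K + κ K ≤ vol * δ K) (hδ : Summable δ) : NE7.Target vol l₀ δ Z := by
  have h0 : |(0 : ℝ)| ≤ l₀ := by simpa using hl₀
  -- per `(K, τ, t)`: positivity of the four class weights and (RM) from §1
  have key : ∀ K, ∀ τ ∈ T K, ∀ t, |t| ≤ l₀ →
      0 < A K t τ ∧ 0 < A K 0 τ ∧ 0 < B K t τ ∧ 0 < B K 0 τ ∧
      |(Real.log (B K t τ) - Real.log (B K 0 τ)) - (Real.log (A K t τ) - Real.log (A K 0 τ))| ≤ r K := by
    intro K τ hτ t ht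
    obtain ⟨p1, p2, p3, p4, h⟩ := responseMatching_of_classGas (ha K τ) (hd K τ) (he K τ) (hωA K τ hτ t ht) (hωA K τ hτ 0 h0)
      (hωB K τ hτ t ht) (hωB K τ hτ 0 h0) (hdom K τ hτ) (hAr K τ t) (hAr K τ 0) (hBr K τ t) (hBr K τ 0) (hSA K τ hτ t ht)
      (hSB K τ hτ t ht) (hm K τ hτ) (hFA K τ) (hFB K τ)
    rw [← hAread K t ht τ hτ] at p1
    rw [← hAread K 0 h0 τ hτ] at p2
    rw [← hBread K t ht τ hτ] at p3
    rw [← hBread K 0 h0 τ hτ] at p4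
    rw [← hAread K t ht τ hτ, ← hAread K 0 h0 τ hτ, ← hBread K t ht τ hτ, ← hBread K 0 h0 τ hτ] at h
    exact ⟨p1, p2, p3, p4, h.trans (hbud K τ hτ t ht)⟩
  exact target_of_responseDecorrelationReading hl₀ T A B r κ hT (fun K t ht τ hτ => (key K τ hτ t ht).1)
    (fun K t ht τ hτ => (key K τ hτ t ht).2.2.1) (fun K t ht τ hτ => (key K τ hτ t ht).2.2.2.2) hDC hZA hZB hδbud hδ

/-! ## §3 Sanity: the displayed binders are jointly inhabited (content-free) -/

/-- SANITY (A6): ONE class (`Unit`), the EMPTY polymer volume (total incompatibility on `Unit`), unit prefactors, zero activities and budgets, `Z ≡ 1` —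
every hypothesis of `target_of_classGasDecorrelationReading` is inhabited and it returns `Target 1 l₀ 0 1` — as an `example` (the statement coincides with
FILE B's `target_of_sourceLocalReading_empty`, already a tree declaration).  Content-free; joint satisfiability only. [folklore] -/
example {l₀ : ℝ} (hl₀ : 0 ≤ l₀) : NE7.Target 1 l₀ (fun _ => 0) (fun _ _ => (1 : ℝ)) := by
  haveI hrefl : Std.Refl (fun _ _ : Unit => True) := ⟨fun _ => trivial⟩
  haveI hsymm : Std.Symm (fun _ _ : Unit => True) := ⟨fun _ _ _ => trivial⟩
  refine target_of_classGasDecorrelationReading (P := Unit) (inc := fun _ _ : Unit => True) (ι := Unit) hl₀ (fun _ => Finset.univ)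
    (fun _ _ => (∅ : Finset Unit)) (fun _ _ => (∅ : Finset Unit)) (fun _ _ _ _ => (0 : ℂ)) (fun _ _ _ _ => (0 : ℂ))
    (fun _ _ _ => 0) (fun _ _ _ => 0) (fun _ _ _ => 0) (fun _ _ _ => 0) (fun _ _ _ => 0) (fun _ _ => 1) (fun _ _ => 1)
    (fun _ _ _ => 1) (fun _ _ _ => 1) (fun _ => 0) (fun _ => 0) (fun _ => Finset.univ_nonempty)
    (fun _ _ _ => le_rfl) (fun _ _ _ => le_rfl) (fun _ _ _ => le_rfl) ?_ ?_ ?_ ?_ ?_ ?_ ?_ ?_ (fun _ _ => one_pos) (fun _ _ => one_pos)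
    ?_ ?_ ?_ ?_ ?_ ?_ (fun K => by simp) summable_zero
  · intro K τ _ t _ δ' hδ'; simp at hδ'
  · intro K τ _ t _ δ' hδ'; simp at hδ'
  · intro K τ _ γ hγ; simp at hγ
  · intro K τ t γ; simp
  · intro K τ t γ; simp
  · intro K τ _ t _ γ hγ; simp at hγ
  · intro K τ _ t _ γ hγ; simp at hγ
  · intro K τ _ C hC hCS; simp [Finset.subset_empty.1 hC] at hCS
  · intro K t _ τ _; simp [polymerPartitionFunction, isCompatible_empty]
  · intro K t _ τ _; simp [polymerPartitionFunction, isCompatible_empty]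
  · intro K t _; simp
  · intro K t _; simp
  · intro K τ _ t _; simp
  · intro K t _; simp

/-! ## §4 (v1.1, append-only) SOURCED prefactors: classes whose block factors FEEL the loop — (RM) = prefactor response matching + the gas budget -/

/-- **RESPONSE MATCHING OF A CLASS GAS WITH SOURCED PREFACTORS** (v1.1).  When the class's block factors DO depend on the source (a recent large-field block AT
the loop: `FA_s`, `FB_s`, `s ∈ {t, 0}`), the prefactors no longer cancel; they contribute their OWN two-run response-matching letter
`|(log FB_t − log FB_0) − (log FA_t − log FA_0)| ≤ r_F` — a two-run comparison of RECENT block factors at the loop (recent ⇒ small in the T4 design; a BINDER here) —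
and `|(log B_t − log B_0) − (log A_t − log A_0)| ≤ r_F +` the discounted two-run activity budget of the class gas.  §1 is the case `FA_t = FA_0`, `FB_t = FB_0`,
`r_F = 0`. [folklore] -/
theorem responseMatching_of_classGas_sourcedPrefactor {wA wA₀ wB wB₀ : P → ℂ} {ω a d e m : P → ℝ} {L S : Finset P} {FAt FA0 FBt FB0 rF : ℝ}
    (ha : ∀ γ, 0 ≤ a γ) (hd : ∀ γ, 0 ≤ d γ) (he : ∀ γ, 0 ≤ e γ)
    (hωA : ∀ δ ∈ L, ‖wA δ‖ ≤ ω δ) (hωA₀ : ∀ δ ∈ L, ‖wA₀ δ‖ ≤ ω δ) (hωB : ∀ δ ∈ L, ‖wB δ‖ ≤ ω δ) (hωB₀ : ∀ δ ∈ L, ‖wB₀ δ‖ ≤ ω δ)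
    (hdom : ∀ γ ∈ L, ∑ γ' ∈ L with inc γ' γ, ω γ' * Real.exp (a γ' + (d γ' + e γ')) ≤ a γ)
    (hAr : ∀ γ, (wA γ).im = 0) (hA₀r : ∀ γ, (wA₀ γ).im = 0) (hBr : ∀ γ, (wB γ).im = 0) (hB₀r : ∀ γ, (wB₀ γ).im = 0)
    (hSA : ∀ γ ∈ L, γ ∉ S → wA γ = wA₀ γ) (hSB : ∀ γ ∈ L, γ ∉ S → wB γ = wB₀ γ)
    (hm : ∀ C ⊆ L, (C ∩ S).Nonempty → IsPolymerCluster inc C → ∀ δ ∈ C, m δ ≤ ∑ γ ∈ C, e γ)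
    (hFAt : 0 < FAt) (hFA0 : 0 < FA0) (hFBt : 0 < FBt) (hFB0 : 0 < FB0)
    (hF : |(Real.log FBt - Real.log FB0) - (Real.log FAt - Real.log FA0)| ≤ rF) :
    |(Real.log (FBt * (polymerPartitionFunction inc wB L).re) - Real.log (FB0 * (polymerPartitionFunction inc wB₀ L).re)) -
        (Real.log (FAt * (polymerPartitionFunction inc wA L).re) - Real.log (FA0 * (polymerPartitionFunction inc wA₀ L).re))| ≤
      rF + ∑ δ ∈ L, Real.exp (-m δ) * ((‖wA δ - wB δ‖ + ‖wA₀ δ - wB₀ δ‖) * Real.exp (a δ + (d δ + e δ))) := by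
  obtain ⟨hpA, hpA₀, hpB, hpB₀, hincr⟩ :=
    abs_log_re_incr_sub_incr_le_local ha hd he hωA hωA₀ hωB hωB₀ hdom hAr hA₀r hBr hB₀r hSA hSB hm
  rw [Real.log_mul hFBt.ne' hpB.ne', Real.log_mul hFB0.ne' hpB₀.ne', Real.log_mul hFAt.ne' hpA.ne', Real.log_mul hFA0.ne' hpA₀.ne']
  have e : Real.log FBt + Real.log (polymerPartitionFunction inc wB L).re - (Real.log FB0 + Real.log (polymerPartitionFunction inc wB₀ L).re) -
      (Real.log FAt + Real.log (polymerPartitionFunction inc wA L).re - (Real.log FA0 + Real.log (polymerPartitionFunction inc wA₀ L).re)) =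
      ((Real.log FBt - Real.log FB0) - (Real.log FAt - Real.log FA0)) +
        ((Real.log (polymerPartitionFunction inc wB L).re - Real.log (polymerPartitionFunction inc wA L).re) -
          (Real.log (polymerPartitionFunction inc wB₀ L).re - Real.log (polymerPartitionFunction inc wA₀ L).re)) := by ring
  rw [e]
  exact (abs_add_le _ _).trans (add_le_add hF hincr)

/-! ## §5 (v1.1) The road plugged into node U4's transport arithmetic: budgets bounded by a TRANSPORTED INJECTED RATE are summable -/

/-- **`Target` WITH THE T4 TRANSPORTED REMAINDER.**  If the road's budgets obey `r K + κ K ≤ vol · T4CauchySum.delta E ρ inj K` with an INJECTED RATE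
`InjectedRate C c θ inj` (`0 ≤ θ < 1`: geometric in the scale of injection, polynomial `(K+1)^c` in the number of steps — node U2's asymptotic-freedom factor) transported
by the irrelevance contraction `0 ≤ ρ < 1` (node U4, [Balaban1988Convergent] Thm 2 (2.43) as a SHAPE), then `Σ_K delta < ∞` by the tree's `T4CauchySum.summable_delta` and
the road gives `NE7.Target vol l₀ (delta E ρ inj) Z`.  Bookkeeping only: the injected rate for Bałaban's runs is nodes NE2–NE5's, produced by nobody here. [folklore] -/
theorem target_of_responseDecorrelationReading_of_injectedRate {ι : Type*} {l₀ vol : ℝ} {Z : ℕ → ℝ → ℝ} (hl₀ : 0 ≤ l₀)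
    (T : ℕ → Finset ι) (A B : ℕ → ℝ → ι → ℝ) (r κ : ℕ → ℝ) {C θ E ρ : ℝ} {c : ℕ} {inj : ℕ → ℕ → ℝ}
    (hinj : Literature.MathematicalPhysics.QuantumFieldTheory.Balaban1983to89.T4CauchySum.InjectedRate C c θ inj) (hE : 0 ≤ E)
    (hθ : 0 ≤ θ) (hθ1 : θ < 1) (hρ : 0 ≤ ρ) (hρ1 : ρ < 1)
    (hT : ∀ K, (T K).Nonempty) (hA : ∀ K t, |t| ≤ l₀ → ∀ τ ∈ T K, 0 < A K t τ) (hB : ∀ K t, |t| ≤ l₀ → ∀ τ ∈ T K, 0 < B K t τ)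
    (hRM : ∀ K t, |t| ≤ l₀ → ∀ τ ∈ T K,
      |(Real.log (B K t τ) - Real.log (B K 0 τ)) - (Real.log (A K t τ) - Real.log (A K 0 τ))| ≤ r K)
    (hDC : ∀ K t, |t| ≤ l₀ →
      |Real.log (∑ τ ∈ T K, B K 0 τ * (A K t τ / A K 0 τ)) - Real.log (∑ τ ∈ T K, B K 0 τ) -
        (Real.log (∑ τ ∈ T K, A K t τ) - Real.log (∑ τ ∈ T K, A K 0 τ))| ≤ κ K)
    (hZA : ∀ K t, |t| ≤ l₀ → Z K t = ∑ τ ∈ T K, A K t τ) (hZB : ∀ K t, |t| ≤ l₀ → Z (K + 1) t = ∑ τ ∈ T K, B K t τ)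
    (hbud : ∀ K, r K + κ K ≤ vol * Literature.MathematicalPhysics.QuantumFieldTheory.Balaban1983to89.T4CauchySum.delta E ρ inj K) :
    NE7.Target vol l₀ (Literature.MathematicalPhysics.QuantumFieldTheory.Balaban1983to89.T4CauchySum.delta E ρ inj) Z :=
  target_of_responseDecorrelationReading hl₀ T A B r κ hT hA hB hRM hDC hZA hZB hbud
    (Literature.MathematicalPhysics.QuantumFieldTheory.Balaban1983to89.T4CauchySum.summable_delta hinj hE hθ hθ1 hρ hρ1)

end Summit.QuantumFields.YangMills.BalabanUVNodes.N19TargetOfClassGasDecorrelation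

end
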